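import Summits.KontsevichZagierPeriods.KontsevichZagierPeriods.Theorems.UnfoldedStokesStokesGenerationStubSaDlogValue
import Summits.KontsevichZagierPeriods.KontsevichZagierPeriods.Theorems.UnfoldedStokesStokesGenerationStubSaLoopAngleExp
import Mathlib.MeasureTheory.Integral.IntervalIntegral.FundThmCalculus

/-!
# `StokesGeneration` (stmt-KontsevichZagierPeriods-3586), line `fibrewise_stokes`, stub `stub_saMixedValue` (rung 10, X7)

The registered stub `stub_saMixedValue` of the line `Cruxes/StokesGeneration/Lines/fibrewise_stokes.lean`
(rung 10, mixed exact + dlog + angular integrands on `[0,1]`, redone for semialgebraic `C¹` data —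
plain functions instead of the polynomials of rung 8, `stub_mixedValue`): if `t : IntegralRep 1` has
domain the closed unit cube of `ℝ¹ = (Fin 1 → ℝ)` and its integrand agrees on the cube with
`z ↦ g₀ (z 0) + Σᵢ cᵢ fᵢ′(z 0)/fᵢ(z 0) + Σₖ dₖ (Aₖ Bₖ′ − Aₖ′ Bₖ)(z 0)/(Aₖ² + Bₖ²)(z 0)`,
where `G₀′ = g₀` on `[0,1]` (`g₀` continuous on `[0,1]`), every `fᵢ` is positive and continuous on
`[0,1]` with derivative `fᵢ′` on `(0,1)` (`fᵢ′` continuous on `[0,1]`), and `Aₖ, Bₖ, Aₖ′, Bₖ′` are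
continuous on `[0,1]` with `Aₖ² + Bₖ²` non-vanishing there, then
`t.value = (G₀ 1 − G₀ 0) + Σᵢ cᵢ log(fᵢ(1)/fᵢ(0)) + Σₖ dₖ ∫₀¹ (Aₖ Bₖ′ − Aₖ′ Bₖ)/(Aₖ² + Bₖ²)`.
(No differentiability of `Aₖ, Bₖ` is needed for the value: only continuity of the four functions.)

Proof: transport the set integral over the cube of `ℝ¹` to `∫ y in Icc 0 1`
(`setIntegral_cubePi_one_eq`, stub R1), pass to the interval integral on `0..1`, split the three
blocks and the two finite sums (every summand is continuous on `[0,1]`, hence interval integrable;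
the angular summands by `saLoopAngle_integrand_continuousOn` of stub X3), evaluate the exact block
by `intervalIntegral_exactPart_eq_sub` (stub R6) and the dlog block by
`intervalIntegral_const_mul_logDeriv_fun` (stub X2), and pull the constants `dₖ` out of the angular
integrals. [Kontsevich–Zagier 2001, §1.1]
-/

noncomputable section

set_option linter.dupNamespace false

namespace Summit.KontsevichZagierPeriods.KontsevichZagierPeriods.Cruxes.StokesGeneration.FibrewiseStokes

open MeasureTheory Set
open Literature.NumberTheory.Transcendental
open Literature.NumberTheory.Transcendental.KZ

/-- Each angular summand `u ↦ d · (A B′ − A′ B)(u)/(A² + B²)(u)` of four functions `A, B, A′, B′`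
continuous on `[0,1]` with `A² + B² ≠ 0` on `[0,1]` is interval integrable on `0..1` (it is
continuous on `[0,1]`, `saLoopAngle_integrand_continuousOn`). [folklore] -/
theorem intervalIntegrable_const_mul_saMixedAngular (d : ℝ) {A B A' B' : ℝ → ℝ}
    (hAB : ∀ u ∈ Set.Icc (0:ℝ) 1, A u ^ 2 + B u ^ 2 ≠ 0)
    (hA : ContinuousOn A (Set.Icc (0:ℝ) 1)) (hB : ContinuousOn B (Set.Icc (0:ℝ) 1))
    (hA' : ContinuousOn A' (Set.Icc (0:ℝ) 1)) (hB' : ContinuousOn B' (Set.Icc (0:ℝ) 1)) :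
    IntervalIntegrable (fun u : ℝ => d * ((A u * B' u - A' u * B u) / (A u ^ 2 + B u ^ 2)))
      volume 0 1 := by
  refine (continuousOn_const.mul ?_).intervalIntegrable
  rw [Set.uIcc_of_le zero_le_one]
  exact saLoopAngle_integrand_continuousOn hA hB hA' hB' hAB

/-- STUB X7 (rung 10, mixed sector) **value of a semialgebraic exact-plus-dlog-plus-angular
representation**: if `t : IntegralRep 1` has domain the closed unit cube of `ℝ¹` and integrand
agreeing there with
`z ↦ g₀ (z 0) + Σᵢ cᵢ fᵢ′(z 0)/fᵢ(z 0) + Σₖ dₖ (Aₖ Bₖ′ − Aₖ′ Bₖ)(z 0)/(Aₖ² + Bₖ²)(z 0)`, where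
`G₀′ = g₀` on `[0,1]`, `g₀` is continuous on `[0,1]`, every `fᵢ` is positive and continuous on
`[0,1]` with derivative `fᵢ′` on `(0,1)` and `fᵢ′` continuous on `[0,1]`, and `Aₖ, Bₖ, Aₖ′, Bₖ′` are
continuous on `[0,1]` with `Aₖ² + Bₖ²` non-vanishing on `[0,1]`, then
`t.value = (G₀ 1 − G₀ 0) + Σᵢ cᵢ log(fᵢ(1)/fᵢ(0)) + Σₖ dₖ ∫₀¹ (Aₖ Bₖ′ − Aₖ′ Bₖ)/(Aₖ² + Bₖ²)`
(transport `ℝ¹ → ℝ`, split, FTC-2 for `G₀` and for `log ∘ fᵢ`, constants out of the angular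
integrals). [cite: KontsevichZagier2001, §1.1] -/
theorem stub_saMixedValue :
    ∀ (s : ℕ) (f f' : Fin s → ℝ → ℝ) (c : Fin s → ℝ) (s' : ℕ) (A B A' B' : Fin s' → ℝ → ℝ)
      (d : Fin s' → ℝ) (G₀ g₀ : ℝ → ℝ),
      (∀ i, ∀ u ∈ Set.Icc (0:ℝ) 1, 0 < f i u) → (∀ i, ContinuousOn (f i) (Set.Icc (0:ℝ) 1)) →
      (∀ i, ContinuousOn (f' i) (Set.Icc (0:ℝ) 1)) → (∀ i, ∀ u ∈ Set.Ioo (0:ℝ) 1, HasDerivAt (f i) (f' i u) u) →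
      (∀ k, ∀ u ∈ Set.Icc (0:ℝ) 1, A k u ^ 2 + B k u ^ 2 ≠ 0) →
      (∀ k, ContinuousOn (A k) (Set.Icc (0:ℝ) 1)) → (∀ k, ContinuousOn (B k) (Set.Icc (0:ℝ) 1)) →
      (∀ k, ContinuousOn (A' k) (Set.Icc (0:ℝ) 1)) → (∀ k, ContinuousOn (B' k) (Set.Icc (0:ℝ) 1)) →
      (∀ u ∈ Set.Icc (0:ℝ) 1, HasDerivAt G₀ (g₀ u) u) → ContinuousOn g₀ (Set.Icc (0:ℝ) 1) →
      ∀ (t : IntegralRep 1), t.domain = Set.pi Set.univ (fun _ : Fin 1 => Set.Icc (0:ℝ) 1) →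
      (∀ z ∈ Set.pi Set.univ (fun _ : Fin 1 => Set.Icc (0:ℝ) 1), t.integrand z =
        g₀ (z 0) + ∑ i, c i * (f' i (z 0) / f i (z 0)) +
          ∑ k, d k * ((A k (z 0) * B' k (z 0) - A' k (z 0) * B k (z 0)) / (A k (z 0) ^ 2 + B k (z 0) ^ 2))) →
      t.value = (G₀ 1 - G₀ 0) + ∑ i, c i * Real.log (f i 1 / f i 0) +
        ∑ k, d k * ∫ u in (0:ℝ)..1, (A k u * B' k u - A' k u * B k u) / (A k u ^ 2 + B k u ^ 2) := by
  intro s f f' c s' A B A' B' d G₀ g₀ hpos hf hf' hderiv hAB hA hB hA' hB' hG hg t ht hti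
  have hmeas : MeasurableSet (Set.pi Set.univ (fun _ : Fin 1 => Set.Icc (0:ℝ) 1)) :=
    MeasurableSet.univ_pi fun _ => measurableSet_Icc
  have hg_int : IntervalIntegrable g₀ volume 0 1 := by
    refine ContinuousOn.intervalIntegrable ?_
    rw [Set.uIcc_of_le zero_le_one]
    exact hg
  have hsum_int : IntervalIntegrable
      (fun u : ℝ => ∑ i, c i * (f' i u / f i u)) volume 0 1 :=
    (continuousOn_finsetSum Finset.univ fun i _ =>
      continuousOn_const.mul (continuousOn_logDeriv_fun (hpos i) (hf i) (hf' i))).intervalIntegrable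
  have hexdlog_int : IntervalIntegrable
      (fun u : ℝ => g₀ u + ∑ i, c i * (f' i u / f i u)) volume 0 1 :=
    hg_int.add hsum_int
  have hang_cont : ∀ k, ContinuousOn
      (fun u : ℝ => (A k u * B' k u - A' k u * B k u) / (A k u ^ 2 + B k u ^ 2))
        (Set.uIcc (0:ℝ) 1) := by
    intro k
    rw [Set.uIcc_of_le zero_le_one]
    exact saLoopAngle_integrand_continuousOn (hA k) (hB k) (hA' k) (hB' k) (hAB k)
  have hang_int : IntervalIntegrable
      (fun u : ℝ => ∑ k, d k * ((A k u * B' k u - A' k u * B k u) / (A k u ^ 2 + B k u ^ 2)))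
        volume 0 1 :=
    (continuousOn_finsetSum Finset.univ fun k _ =>
      continuousOn_const.mul (hang_cont k)).intervalIntegrable
  rw [IntegralRep.value, ht, setIntegral_congr_fun hmeas hti,
    setIntegral_cubePi_one_eq
      (fun y => g₀ y + ∑ i, c i * (f' i y / f i y) +
        ∑ k, d k * ((A k y * B' k y - A' k y * B k y) / (A k y ^ 2 + B k y ^ 2))),
    integral_Icc_eq_integral_Ioc, ← intervalIntegral.integral_of_le zero_le_one,
    intervalIntegral.integral_add hexdlog_int hang_int,
    intervalIntegral.integral_add hg_int hsum_int,
    intervalIntegral.integral_finsetSum (s := Finset.univ)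
      (fun i _ => intervalIntegrable_const_mul_logDeriv_fun (c i) (hpos i) (hf i) (hf' i)),
    intervalIntegral.integral_finsetSum (s := Finset.univ)
      (fun k _ => intervalIntegrable_const_mul_saMixedAngular (d k) (hAB k) (hA k) (hB k) (hA' k)
        (hB' k)),
    intervalIntegral_exactPart_eq_sub hG hg]
  congr 1
  · congr 1
    exact Finset.sum_congr rfl fun i _ =>
      intervalIntegral_const_mul_logDeriv_fun (c i) (hpos i) (hf i) (hf' i) (hderiv i)
  · exact Finset.sum_congr rfl fun k _ => intervalIntegral.integral_const_mul _ _

end Summit.KontsevichZagierPeriods.KontsevichZagierPeriods.Cruxes.StokesGeneration.FibrewiseStokes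

end
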